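import Literature.NumberTheory.GelbartRogawski1991.UnitaryDualPairWeilCoinvariantsConjTransport
import Literature.NumberTheory.GelbartRogawski1991.FiniteAdelicRationalImplementerFamily
import Literature.NumberTheory.Automorphic.Liu2021.Def411WeilCarriersDoubling
import Literature.NumberTheory.Automorphic.UnitaryGroupLevelTransport
import Literature.NumberTheory.Weil1964.AdelicMetaplecticFinRepBlockDiag
import HarnessLib

/-!
# Liu 2021 Def. 4.11 — frame independence of the χ-attached finite Weil representation: the statement and its join frame

The Weil carriers of [Liu2021, Def. 4.11] are built at a real diagonal FRAME `dV` of the hermitian space `V` (Gram matrix `diag dV`)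
and at the χ-attached splitting `s_χ[dV]` of the unitary dual pair `U(V) × U(W)` ([GelbartRogawski1991, §3.1]).  This file states,
as ONE `Prop`, that the resulting finite Weil representation does not depend on the frame — two frames `dV, dV′` related by a
rational isometry `B` give representations conjugate by one linear automorphism of `𝒮((𝔸_{L⁺,f})^N)` over `finAdelicCongr B`
(`chiSplittingFrameTransport`) — and reduces it to the output shape of the model construction (a decomposable conjugator `r`,
a point homomorphism `θ` and a Kronecker operator identity `hω`):

* §1 `chiSplittingFrameTransport` and `chiSplittingFrameTransport_of_pieces` (the join over `finPairRep_eq_conj_of_omega_conj`);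
* §2 `exists_omega_tmul_ratPointsThetaLiftCont_realDiagonal` — clause `hq` for ANY `r = r_{L⁺}(h)`, `h` a rational point of
  `Sp(𝕎_{diag dV ⊗ diag dW})(𝔸)` given as a member of the range subgroup (`exists_omega_tmul_ratPointsThetaLiftCont` at
  `T_R := realDiagonal dV ⊗ₖ realDiagonal dW`);
* §3 `chiSplittingLine_realDiagonal` — at the W-data `(realDiagonal dW, diagonal dW)` the line splitting IS `chiSplitting[dW]`;
  `chiSplittingFrameTransport_of_model_pieces` — the statement follows from the pieces stated in the MODEL (`dW`-quantified,
  `J_W := diagonal dW`, `hω` at `chiSplitting`), the general line `(T_W, hW, hWd, J_W, hJW)` being reduced to it by `dW := lineW T_W`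
  (`realDiagonal_lineW`, `diagonal_lineW`) and proof irrelevance — stated through an opaque predicate so that no motive ever
  contains the telescopes of the statement;
* §4 `exists_gramTransporter` — the rational Gram transporter `C₀` with `(diag dV ⊗ diag dW) C₀ = diag dV′ ⊗ diag dW`.

The proof `chiSplittingFrameTransport_holds` (assembly of the model pieces) is in `Def411WeilCarriersFrameTransportHolds`.
References: [Weil1964] Chap. III n° 38–40; [MoeglinVignerasWaldspurger1987] Chap. 2 II.1; [GelbartRogawski1991] §3.1 Prop. 3.1.1,
Remark p. 457; [Liu2021] Def. 4.11, App. D §D.1; [Kudla1994] §2.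
-/

set_option autoImplicit false

noncomputable section

open scoped Matrix Kronecker TensorProduct SchwartzMap Classical
open NumberField NumberField.mixedEmbedding IsDedekindDomain
open Literature.NumberTheory.Automorphic Literature.NumberTheory.Automorphic.UnitaryGroup
open Literature.NumberTheory.Weil1964 Literature.RepresentationTheory.HeisenbergGroup
open Literature.RepresentationTheory.HeisenbergGroup.SymplecticMatrix (transportSp mapHom)
open Literature.NumberTheory.GaloisRepresentations

namespace Literature.NumberTheory.Automorphic.Liu2021.Def411WeilCarriersDoubling

open Literature.NumberTheory.GelbartRogawski1991 Literature.NumberTheory.GelbartRogawski1991.UnitaryDualPair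
open Literature.NumberTheory.GelbartRogawski1991.UnitaryDualPair.WeilCoinv
open Literature.NumberTheory.GelbartRogawski1991.UnitaryDualPair.LocalSplitting
open Literature.NumberTheory.GelbartRogawski1991.GRConstruction
open Literature.RepresentationTheory.HarrisKudlaSweet1996

/-! ## §1 The statement and its derivation from the pieces' output shape -/

/-- **FRAME INDEPENDENCE OF THE χ-ATTACHED FINITE WEIL REPRESENTATION** (the statement, one `Prop`).
For real diagonal frames `dV`, `dV′` related by a rational ISOMETRY `B` (`formCongr c̄ B (1 • diag dV′) = diag dV`), the finite Weil
representations at the χ-attached splittings of the line datum are conjugate by one linear automorphism `Q` of `𝒮((𝔸_{L⁺,f})^N)`,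
over `finAdelicCongr B` on `U(V)` and identically on `U(W)`. [cite: Liu2021, Def. 4.11 (l. 2092–2096); App. D §D.1 Step 2 (l. 5219)]
[cite: MoeglinVignerasWaldspurger1987, Chap. 2 II.1] [cite: Kudla1994, §2 (doubled space, Siegel parabolic), Thm. 3.1]
[cite: GelbartRogawski1991, §3.1 Remark p. 457] -/
def chiSplittingFrameTransport : Prop :=
  ∀ (L : Type) [Field L] [NumberField L] [IsCMField L] {N n : ℕ} (e : Fin N × Fin 1 ≃ Fin n)
    (dV : Fin N → L) (hdV : ∀ i, IsCMField.complexConj L (dV i) = dV i) (hdV0 : ∀ i, dV i ≠ 0)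
    (dV' : Fin N → L) (hdV' : ∀ i, IsCMField.complexConj L (dV' i) = dV' i) (hdV'0 : ∀ i, dV' i ≠ 0)
    (B : GL (Fin N) L)
    (hB : formCongr ((IsCMField.complexConj L : L ≃ₐ[Fp L] L) : L →+* L) B ((1 : L) • Matrix.diagonal dV') = Matrix.diagonal dV)
    (χ : HeckeCharacter L) (hχu : χ.IsUnitary) (hχs : IsSplittingChar L 1 χ)
    (TW : Matrix (Fin 1) (Fin 1) (Fp L)) (hW : TW.IsSymm) (hWd : IsUnit TW.det) (JW : Matrix (Fin 1) (Fin 1) L)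
    (hJW : JW = TW.map (algebraMap (Fp L) L)),
    ∃ Q : FinSB (Fp L) (Fin N × Fin 1) ≃ₗ[ℂ] FinSB (Fp L) (Fin N × Fin 1),
      ∀ (k : finAdelic (Fp L) L (IsCMField.complexConj L) N (Matrix.diagonal dV))
        (u : finAdelic (Fp L) L (IsCMField.complexConj L) 1 JW),
        finPairRep (Fp L) L (IsCMField.complexConj L) N 1 e (Matrix.diagonal dV') JW (complexConj_imagUnit L)
            (imagUnit_ne_zero L) (imagUnit_mul_self L) (realDiagonal_isSymm L dV' hdV') hW
            (isUnit_det_realDiagonal L dV' hdV' hdV'0) hWd (realDiagonal_map L dV' hdV').symm hJW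
            (isCompatible_chiSplittingLine L e dV' hdV' hdV'0 χ hχu hχs TW hW hWd JW hJW)
            (finAdelicCongr (Fp L) L (IsCMField.complexConj L) B one_ne_zero hB k, u) =
          Q.conj
            (finPairRep (Fp L) L (IsCMField.complexConj L) N 1 e (Matrix.diagonal dV) JW (complexConj_imagUnit L)
              (imagUnit_ne_zero L) (imagUnit_mul_self L) (realDiagonal_isSymm L dV hdV) hW
              (isUnit_det_realDiagonal L dV hdV hdV0) hWd (realDiagonal_map L dV hdV).symm hJW
              (isCompatible_chiSplittingLine L e dV hdV hdV0 χ hχu hχs TW hW hWd JW hJW) (k, u))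


/-- **THE STATEMENT FROM THE PIECES' OUTPUT SHAPE** (the final join, modulo producing the data): if for every datum the model
construction supplies a decomposable conjugator `r` (`hq`), a group homomorphism `θ` over `(finAdelicCongr B)⁻¹` on the
`V`-points and the identity on the `W`-points, and the Kronecker operator identity `hω` for the two χ-ATTACHED splittings, then
`chiSplittingFrameTransport` holds (with `Q := Q_f⁻¹`). [cite: Liu2021, Def. 4.11 (l. 2092–2096)] [cite: MoeglinVignerasWaldspurger1987, Chap. 2 II.1]
[cite: Kudla1994, §2 (doubled space, Siegel parabolic), Thm. 3.1] -/
theorem chiSplittingFrameTransport_of_pieces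
    (H : ∀ (L : Type) [Field L] [NumberField L] [IsCMField L] {N n : ℕ} (e : Fin N × Fin 1 ≃ Fin n)
      (dV : Fin N → L) (hdV : ∀ i, IsCMField.complexConj L (dV i) = dV i) (hdV0 : ∀ i, dV i ≠ 0)
      (dV' : Fin N → L) (hdV' : ∀ i, IsCMField.complexConj L (dV' i) = dV' i) (hdV'0 : ∀ i, dV' i ≠ 0)
      (B : GL (Fin N) L)
      (hB : formCongr ((IsCMField.complexConj L : L ≃ₐ[Fp L] L) : L →+* L) B ((1 : L) • Matrix.diagonal dV') = Matrix.diagonal dV)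
      (χ : HeckeCharacter L) (hχu : χ.IsUnitary) (hχs : IsSplittingChar L 1 χ)
      (TW : Matrix (Fin 1) (Fin 1) (Fp L)) (hW : TW.IsSymm) (hWd : IsUnit TW.det) (JW : Matrix (Fin 1) (Fin 1) L)
      (hJW : JW = TW.map (algebraMap (Fp L) L)),
      ∃ (r : adelicMpCont (Fp L) (Fin N × Fin 1)
          ((realDiagonal L dV hdV).map (algebraMap (Fp L) (AdeleRing (𝓞 (Fp L)) (Fp L))) ⊗ₖ
            TW.map (algebraMap (Fp L) (AdeleRing (𝓞 (Fp L)) (Fp L)))))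
        (A : 𝓢(((Fin N × Fin 1) → mixedSpace (Fp L)), ℂ) ≃L[ℂ] 𝓢(((Fin N × Fin 1) → mixedSpace (Fp L)), ℂ))
        (Qf : FinSB (Fp L) (Fin N × Fin 1) ≃ₗ[ℂ] FinSB (Fp L) (Fin N × Fin 1))
        (θ : adelicPair (Fp L) L (IsCMField.complexConj L) N 1 (Matrix.diagonal dV') JW →*
          adelicPair (Fp L) L (IsCMField.complexConj L) N 1 (Matrix.diagonal dV) JW),
        (∀ (Φinf : 𝓢(((Fin N × Fin 1) → mixedSpace (Fp L)), ℂ)) (f : FinSB (Fp L) (Fin N × Fin 1)),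
          adelicMpCont.omega (Fp L) (Fin N × Fin 1) _ r (piSchwartzBruhatEquiv (Fp L) (Fin N × Fin 1) (Φinf ⊗ₜ f)) =
            piSchwartzBruhatEquiv (Fp L) (Fin N × Fin 1) (A Φinf ⊗ₜ Qf f)) ∧
        (∀ k' : finAdelic (Fp L) L (IsCMField.complexConj L) N (Matrix.diagonal dV'),
          θ (adelicInl (Fp L) L (IsCMField.complexConj L) N 1 (Matrix.diagonal dV') JW
              (finAdelicToAdelic (Fp L) L (IsCMField.complexConj L) N (Matrix.diagonal dV') k')) =
            adelicInl (Fp L) L (IsCMField.complexConj L) N 1 (Matrix.diagonal dV) JW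
              (finAdelicToAdelic (Fp L) L (IsCMField.complexConj L) N (Matrix.diagonal dV)
                ((finAdelicCongr (Fp L) L (IsCMField.complexConj L) B one_ne_zero hB).symm k'))) ∧
        (∀ u : finAdelic (Fp L) L (IsCMField.complexConj L) 1 JW,
          θ (adelicInr (Fp L) L (IsCMField.complexConj L) N 1 (Matrix.diagonal dV') JW
              (finAdelicToAdelic (Fp L) L (IsCMField.complexConj L) 1 JW u)) =
            adelicInr (Fp L) L (IsCMField.complexConj L) N 1 (Matrix.diagonal dV) JW
              (finAdelicToAdelic (Fp L) L (IsCMField.complexConj L) 1 JW u)) ∧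
        (∀ (p' : adelicPair (Fp L) L (IsCMField.complexConj L) N 1 (Matrix.diagonal dV') JW)
          (Ψ : piSchwartzBruhat (Fp L) (Fin N × Fin 1)),
          adelicMpCont.omega (Fp L) (Fin N × Fin 1) _ r
              ((piSBReindex (Fp L) e).symm (adelicMpCont.omega (Fp L) (Fin n)
                (adelicGram (Fp L) e (realDiagonal L dV' hdV') TW)
                (chiSplittingLine L e dV' hdV' hdV'0 χ hχu hχs TW hWd JW hJW p') (piSBReindex (Fp L) e Ψ))) =
            (piSBReindex (Fp L) e).symm (adelicMpCont.omega (Fp L) (Fin n) (adelicGram (Fp L) e (realDiagonal L dV hdV) TW)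
              (chiSplittingLine L e dV hdV hdV0 χ hχu hχs TW hWd JW hJW (θ p'))
              (piSBReindex (Fp L) e (adelicMpCont.omega (Fp L) (Fin N × Fin 1) _ r Ψ))))) :
    chiSplittingFrameTransport := by
  intro L _ _ _ N n e dV hdV hdV0 dV' hdV' hdV'0 B hB χ hχu hχs TW hW hWd JW hJW
  obtain ⟨r, A, Qf, θ, hq, hθinl, hθinr, hω⟩ := H L e dV hdV hdV0 dV' hdV' hdV'0 B hB χ hχu hχs TW hW hWd JW hJW
  refine ⟨Qf.symm, fun k u => ?_⟩
  have h := finPairRep_eq_conj_of_omega_conj (Fp L) L (IsCMField.complexConj L) N 1 e (Matrix.diagonal dV) (Matrix.diagonal dV') JW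
    (complexConj_imagUnit L) (imagUnit_ne_zero L) (imagUnit_mul_self L) (realDiagonal_isSymm L dV hdV)
    (realDiagonal_isSymm L dV' hdV') hW (isUnit_det_realDiagonal L dV hdV hdV0) (isUnit_det_realDiagonal L dV' hdV' hdV'0) hWd
    (realDiagonal_map L dV hdV).symm (realDiagonal_map L dV' hdV').symm hJW
    (isCompatible_chiSplittingLine L e dV hdV hdV0 χ hχu hχs TW hW hWd JW hJW)
    (isCompatible_chiSplittingLine L e dV' hdV' hdV'0 χ hχu hχs TW hW hWd JW hJW) r A Qf hq θ
    (fun k' => (finAdelicCongr (Fp L) L (IsCMField.complexConj L) B one_ne_zero hB).symm k') hθinl hθinr hω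
    (finAdelicCongr (Fp L) L (IsCMField.complexConj L) B one_ne_zero hB k) u
  rw [ContinuousMulEquiv.symm_apply_apply] at h
  exact h


/-! ## §2 Clause `hq`: the Weil operator of `r_{L⁺}(h)` at the Kronecker Gram `diag dV ⊗ diag dW` is decomposable -/

section HQ

variable (L : Type) [Field L] [NumberField L] [IsCMField L] {N M : ℕ}
  (dV : Fin N → L) (hdV : ∀ i, IsCMField.complexConj L (dV i) = dV i) (hdV0 : ∀ i, dV i ≠ 0)
  (dW : Fin M → L) (hdW : ∀ i, IsCMField.complexConj L (dW i) = dW i) (hdW0 : ∀ i, dW i ≠ 0)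

/-- `(diag dV ⊗ 1) ⊗ₖ (diag dW ⊗ 1) = (diag dV ⊗ₖ diag dW) ⊗ 1` in `M(𝔸_{L⁺})`: the Gram matrix of `(V ⊗ W) ⊗ 𝔸` is the Kronecker
product of the Gram matrices. [cite: GelbartRogawski1991, §3.1 p. 454] -/
theorem realDiagonal_map_kronecker_realDiagonal_map :
    (realDiagonal L dV hdV).map (algebraMap (Fp L) (AdeleRing (𝓞 (Fp L)) (Fp L))) ⊗ₖ
        (realDiagonal L dW hdW).map (algebraMap (Fp L) (AdeleRing (𝓞 (Fp L)) (Fp L))) =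
      (realDiagonal L dV hdV ⊗ₖ realDiagonal L dW hdW).map (algebraMap (Fp L) (AdeleRing (𝓞 (Fp L)) (Fp L))) := by
  ext ⟨i, i'⟩ ⟨j, j'⟩
  simp only [Matrix.map_apply, Matrix.kroneckerMap_apply, map_mul]

include hdV0 hdW0 in
/-- `det (diag dV ⊗ₖ diag dW)` is a unit (the tensor product of non-degenerate spaces is non-degenerate).
[cite: GelbartRogawski1991, §3.1 p. 454] -/
theorem isUnit_det_realDiagonal_kronecker : IsUnit (realDiagonal L dV hdV ⊗ₖ realDiagonal L dW hdW).det :=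
  SpTransport.isUnit_det_kronecker (isUnit_det_realDiagonal L dV hdV hdV0) (isUnit_det_realDiagonal L dW hdW hdW0)

include hdV0 hdW0 in
/-- **clause `hq` of the (T) join**: for a rational point `h ∈ Sp(𝕎)(L⁺) ⊆ Sp(𝕎_𝔸)`, `𝕎` with Gram matrix `diag dV ⊗ diag dW`, given as a
member of the range subgroup, the Weil operator of `r_{L⁺}(h) ∈ Mp_ψ(𝕎_𝔸)ᶜᵒⁿᵗ` is decomposable on pure tensors:
`ω(r_{L⁺}(h))(Φ_∞ ⊗ f) = A Φ_∞ ⊗ Q_f f`. [cite: Weil1964, Chap. III n° 38–40 pp. 188–191] [cite: GelbartRogawski1991, §3.1 Prop. 3.1.1 p. 455] -/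
theorem exists_omega_tmul_ratPointsThetaLiftCont_realDiagonal
    (h𝕋d : IsUnit ((realDiagonal L dV hdV).map (algebraMap (Fp L) (AdeleRing (𝓞 (Fp L)) (Fp L))) ⊗ₖ
      (realDiagonal L dW hdW).map (algebraMap (Fp L) (AdeleRing (𝓞 (Fp L)) (Fp L)))).det)
    (g : ((transportSp _ h𝕋d).comp (mapHom (algebraMap (Fp L) (AdeleRing (𝓞 (Fp L)) (Fp L))))).range) :
    ∃ (A : 𝓢(((Fin N × Fin M) → mixedSpace (Fp L)), ℂ) ≃L[ℂ] 𝓢(((Fin N × Fin M) → mixedSpace (Fp L)), ℂ))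
      (Q : FinSB (Fp L) (Fin N × Fin M) ≃ₗ[ℂ] FinSB (Fp L) (Fin N × Fin M)),
      ∀ (Φinf : 𝓢(((Fin N × Fin M) → mixedSpace (Fp L)), ℂ)) (f : FinSB (Fp L) (Fin N × Fin M)),
        adelicMpCont.omega (Fp L) (Fin N × Fin M) _ (ratPointsThetaLiftCont (Fp L) (Fin N × Fin M) _ h𝕋d g)
            (piSchwartzBruhatEquiv (Fp L) (Fin N × Fin M) (Φinf ⊗ₜ f)) =
          piSchwartzBruhatEquiv (Fp L) (Fin N × Fin M) (A Φinf ⊗ₜ Q f) := by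
  have H := exists_omega_tmul_ratPointsThetaLiftCont (F := Fp L) (ι := Fin N × Fin M)
    (realDiagonal L dV hdV ⊗ₖ realDiagonal L dW hdW)
    (isUnit_det_realDiagonal_kronecker L dV hdV hdV0 dW hdW hdW0) (realDiagonal_map_kronecker_realDiagonal_map L dV hdV dW hdW)
    h𝕋d g
  obtain ⟨A, Q, h, -⟩ := H
  exact ⟨A, Q, h⟩

end HQ

/-! ## §3 Reduction of the statement's hermitian line `(T_W, J_W)` to the model `(realDiagonal dW, diagonal dW)` -/

section Model

variable (L : Type) [Field L] [NumberField L] [IsCMField L] {N M n : ℕ} (e : Fin N × Fin M ≃ Fin n)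
  (dV : Fin N → L) (hdV : ∀ i, IsCMField.complexConj L (dV i) = dV i) (hdV0 : ∀ i, dV i ≠ 0)
  (χ : HeckeCharacter L) (hχu : χ.IsUnitary) (hχs : IsSplittingChar L 1 χ)

/-- transporting the lane's `chiSplitting[dW₁]` along `dW₁ = dW` gives `chiSplitting[dW]` (proof irrelevance in the frame proofs).
[cite: GelbartRogawski1991, §3.1 Prop. 3.1.1 p. 455 L1–3] -/
theorem splittingCongr_chiSplitting_of_eq {dW₁ dW : Fin M → L} (hdW₁ : ∀ i, IsCMField.complexConj L (dW₁ i) = dW₁ i)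
    (hdW : ∀ i, IsCMField.complexConj L (dW i) = dW i) (hdW₁0 : ∀ i, dW₁ i ≠ 0) (hdW0 : ∀ i, dW i ≠ 0) (h : dW₁ = dW)
    (hT : realDiagonal L dW₁ hdW₁ = realDiagonal L dW hdW) (hJ : Matrix.diagonal dW₁ = Matrix.diagonal dW) :
    splittingCongr (Fp L) L (IsCMField.complexConj L) N M e (Matrix.diagonal dV) hT hJ
        (chiSplitting L e dV hdV hdV0 dW₁ hdW₁ hdW₁0 χ hχu hχs) =
      chiSplitting L e dV hdV hdV0 dW hdW hdW0 χ hχu hχs := by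
  subst h
  rfl

/-- the entry family of `realDiagonal dW` (a `1 × 1` matrix) is `dW` (the hermitian line `⟨T_W⟩` of [GelbartRogawski1991, §3.1]
in a frame). [cite: GelbartRogawski1991, §3.1 p. 454] -/
theorem lineW_realDiagonal (dW : Fin 1 → L) (hdW : ∀ i, IsCMField.complexConj L (dW i) = dW i) :
    lineW L (realDiagonal L dW hdW) = dW := by
  funext i
  show (((realDiagonal L dW hdW) i i : Fp L) : L) = dW i
  rw [realDiagonal, Matrix.diagonal_apply_eq]

/-- **at the model W-data the line splitting IS the lane's splitting**: `chiSplittingLine[dV] (realDiagonal dW) _ (diagonal dW) _ =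
chiSplitting[dV, dW]`. [cite: GelbartRogawski1991, §3.1 Prop. 3.1.1 p. 455 L1–3] [cite: Liu2021, App. D §D.1 Steps 1–2 (l. 5217–5219)] -/
theorem chiSplittingLine_realDiagonal {N' n' : ℕ} (e₁ : Fin N' × Fin 1 ≃ Fin n')
    (dV₁ : Fin N' → L) (hdV₁ : ∀ i, IsCMField.complexConj L (dV₁ i) = dV₁ i) (hdV₁0 : ∀ i, dV₁ i ≠ 0)
    (dW : Fin 1 → L) (hdW : ∀ i, IsCMField.complexConj L (dW i) = dW i) (hdW0 : ∀ i, dW i ≠ 0)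
    (hWd : IsUnit (realDiagonal L dW hdW).det)
    (hJW : Matrix.diagonal dW = (realDiagonal L dW hdW).map (algebraMap (Fp L) L)) :
    chiSplittingLine L e₁ dV₁ hdV₁ hdV₁0 χ hχu hχs (realDiagonal L dW hdW) hWd (Matrix.diagonal dW) hJW =
      chiSplitting L e₁ dV₁ hdV₁ hdV₁0 dW hdW hdW0 χ hχu hχs := by
  unfold chiSplittingLine
  exact splittingCongr_chiSplitting_of_eq L e₁ dV₁ hdV₁ hdV₁0 χ hχu hχs _ hdW _ hdW0 (lineW_realDiagonal L dW hdW) _ _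

/-- **every hermitian LINE datum is a model datum**: a statement about all `(T_W, hW, hWd, J_W, hJW)` (`T_W ∈ GL₁(L⁺)` symmetric,
`J_W = T_W ⊗ L`) follows from its instances at `(realDiagonal dW, _, _, diagonal dW, _)` for real non-zero `dW : Fin 1 → L` and ARBITRARY
proof arguments — `dW := lineW T_W` (`realDiagonal_lineW`, `diagonal_lineW`).  Stated for an opaque predicate `P` so that the two
`subst`s run in a goal of constant size (the statement's telescopes never enter a motive). [cite: Liu2021, App. D §D.1 Step 1 (l. 5217)]
[cite: GelbartRogawski1991, §3.1 p. 454] -/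
theorem forall_line_of_forall_realDiagonal (L : Type) [Field L] [NumberField L] [IsCMField L]
    (P : ∀ (TW : Matrix (Fin 1) (Fin 1) (Fp L)), TW.IsSymm → IsUnit TW.det → ∀ JW : Matrix (Fin 1) (Fin 1) L,
      JW = TW.map (algebraMap (Fp L) L) → Prop)
    (h : ∀ (dW : Fin 1 → L) (hdW : ∀ i, IsCMField.complexConj L (dW i) = dW i) (_hdW0 : ∀ i, dW i ≠ 0)
      (hW : (realDiagonal L dW hdW).IsSymm) (hWd : IsUnit (realDiagonal L dW hdW).det)
      (hJW : Matrix.diagonal dW = (realDiagonal L dW hdW).map (algebraMap (Fp L) L)),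
      P (realDiagonal L dW hdW) hW hWd (Matrix.diagonal dW) hJW) :
    ∀ (TW : Matrix (Fin 1) (Fin 1) (Fp L)) (hW : TW.IsSymm) (hWd : IsUnit TW.det) (JW : Matrix (Fin 1) (Fin 1) L)
      (hJW : JW = TW.map (algebraMap (Fp L) L)), P TW hW hWd JW hJW := by
  intro TW hW hWd JW hJW
  obtain ⟨dW, hdW, hdW0, rfl⟩ : ∃ (dW : Fin 1 → L) (hdW : ∀ i, IsCMField.complexConj L (dW i) = dW i),
      (∀ i, dW i ≠ 0) ∧ TW = realDiagonal L dW hdW :=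
    ⟨lineW L TW, complexConj_lineW L TW, lineW_ne_zero L TW hWd, (realDiagonal_lineW L TW).symm⟩
  obtain rfl : JW = Matrix.diagonal dW := hJW.trans (realDiagonal_map L dW hdW)
  exact h dW hdW hdW0 hW hWd hJW

/-- **THE STATEMENT FROM THE PIECES STATED IN THE MODEL.**  If for every CM field `L`, frames `dV, dV′` related by a rational isometry `B`,
`χ`, and every real diagonal LINE frame `dW : Fin 1 → L`, the model construction supplies `r, A, Q_f, θ` with `hq`, the point
bookkeeping `hθinl` / `hθinr` over `(finAdelicCongr B)⁻¹` and the identity, and the Kronecker operator identity `hω` for the lane's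
χ-ATTACHED splittings `chiSplitting[dV, dW]`, `chiSplitting[dV′, dW]`, then `chiSplittingFrameTransport` holds: the general line
`(T_W, J_W)` is `(realDiagonal dW, diagonal dW)` for `dW := lineW T_W`. [cite: Liu2021, Def. 4.11 (l. 2092–2096); App. D §D.1 Steps 1–2 (l. 5217–5219)]
[cite: MoeglinVignerasWaldspurger1987, Chap. 2 II.1] [cite: GelbartRogawski1991, §3.1 Prop. 3.1.1 p. 455, Remark p. 457] -/
theorem chiSplittingFrameTransport_of_model_pieces
    (Hm : ∀ (L : Type) [Field L] [NumberField L] [IsCMField L] {N n : ℕ} (e : Fin N × Fin 1 ≃ Fin n)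
      (dV : Fin N → L) (hdV : ∀ i, IsCMField.complexConj L (dV i) = dV i) (hdV0 : ∀ i, dV i ≠ 0)
      (dV' : Fin N → L) (hdV' : ∀ i, IsCMField.complexConj L (dV' i) = dV' i) (hdV'0 : ∀ i, dV' i ≠ 0)
      (B : GL (Fin N) L)
      (hB : formCongr ((IsCMField.complexConj L : L ≃ₐ[Fp L] L) : L →+* L) B ((1 : L) • Matrix.diagonal dV') = Matrix.diagonal dV)
      (χ : HeckeCharacter L) (hχu : χ.IsUnitary) (hχs : IsSplittingChar L 1 χ)
      (dW : Fin 1 → L) (hdW : ∀ i, IsCMField.complexConj L (dW i) = dW i) (hdW0 : ∀ i, dW i ≠ 0),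
      ∃ (r : adelicMpCont (Fp L) (Fin N × Fin 1)
          ((realDiagonal L dV hdV).map (algebraMap (Fp L) (AdeleRing (𝓞 (Fp L)) (Fp L))) ⊗ₖ
            (realDiagonal L dW hdW).map (algebraMap (Fp L) (AdeleRing (𝓞 (Fp L)) (Fp L)))))
        (A : 𝓢(((Fin N × Fin 1) → mixedSpace (Fp L)), ℂ) ≃L[ℂ] 𝓢(((Fin N × Fin 1) → mixedSpace (Fp L)), ℂ))
        (Qf : FinSB (Fp L) (Fin N × Fin 1) ≃ₗ[ℂ] FinSB (Fp L) (Fin N × Fin 1))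
        (θ : adelicPair (Fp L) L (IsCMField.complexConj L) N 1 (Matrix.diagonal dV') (Matrix.diagonal dW) →*
          adelicPair (Fp L) L (IsCMField.complexConj L) N 1 (Matrix.diagonal dV) (Matrix.diagonal dW)),
        (∀ (Φinf : 𝓢(((Fin N × Fin 1) → mixedSpace (Fp L)), ℂ)) (f : FinSB (Fp L) (Fin N × Fin 1)),
          adelicMpCont.omega (Fp L) (Fin N × Fin 1) _ r (piSchwartzBruhatEquiv (Fp L) (Fin N × Fin 1) (Φinf ⊗ₜ f)) =
            piSchwartzBruhatEquiv (Fp L) (Fin N × Fin 1) (A Φinf ⊗ₜ Qf f)) ∧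
        (∀ k' : finAdelic (Fp L) L (IsCMField.complexConj L) N (Matrix.diagonal dV'),
          θ (adelicInl (Fp L) L (IsCMField.complexConj L) N 1 (Matrix.diagonal dV') (Matrix.diagonal dW)
              (finAdelicToAdelic (Fp L) L (IsCMField.complexConj L) N (Matrix.diagonal dV') k')) =
            adelicInl (Fp L) L (IsCMField.complexConj L) N 1 (Matrix.diagonal dV) (Matrix.diagonal dW)
              (finAdelicToAdelic (Fp L) L (IsCMField.complexConj L) N (Matrix.diagonal dV)
                ((finAdelicCongr (Fp L) L (IsCMField.complexConj L) B one_ne_zero hB).symm k'))) ∧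
        (∀ u : finAdelic (Fp L) L (IsCMField.complexConj L) 1 (Matrix.diagonal dW),
          θ (adelicInr (Fp L) L (IsCMField.complexConj L) N 1 (Matrix.diagonal dV') (Matrix.diagonal dW)
              (finAdelicToAdelic (Fp L) L (IsCMField.complexConj L) 1 (Matrix.diagonal dW) u)) =
            adelicInr (Fp L) L (IsCMField.complexConj L) N 1 (Matrix.diagonal dV) (Matrix.diagonal dW)
              (finAdelicToAdelic (Fp L) L (IsCMField.complexConj L) 1 (Matrix.diagonal dW) u)) ∧
        (∀ (p' : adelicPair (Fp L) L (IsCMField.complexConj L) N 1 (Matrix.diagonal dV') (Matrix.diagonal dW))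
          (Ψ : piSchwartzBruhat (Fp L) (Fin N × Fin 1)),
          adelicMpCont.omega (Fp L) (Fin N × Fin 1) _ r
              ((piSBReindex (Fp L) e).symm (adelicMpCont.omega (Fp L) (Fin n)
                (adelicGram (Fp L) e (realDiagonal L dV' hdV') (realDiagonal L dW hdW))
                (chiSplitting L e dV' hdV' hdV'0 dW hdW hdW0 χ hχu hχs p') (piSBReindex (Fp L) e Ψ))) =
            (piSBReindex (Fp L) e).symm (adelicMpCont.omega (Fp L) (Fin n)
              (adelicGram (Fp L) e (realDiagonal L dV hdV) (realDiagonal L dW hdW))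
              (chiSplitting L e dV hdV hdV0 dW hdW hdW0 χ hχu hχs (θ p'))
              (piSBReindex (Fp L) e (adelicMpCont.omega (Fp L) (Fin N × Fin 1) _ r Ψ))))) :
    chiSplittingFrameTransport := by
  refine chiSplittingFrameTransport_of_pieces fun L _ _ _ N n e dV hdV hdV0 dV' hdV' hdV'0 B hB χ hχu hχs => ?_
  refine forall_line_of_forall_realDiagonal L _ fun dW hdW hdW0 hW hWd hJW => ?_
  -- (`have` first: `obtain … := <application>` generalizes the term over the goal and type-checks the motive — a `whnf`
  --  storm through the statement's telescopes; destructuring a local hypothesis does not)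
  have hm := Hm L e dV hdV hdV0 dV' hdV' hdV'0 B hB χ hχu hχs dW hdW hdW0
  obtain ⟨r, A, Qf, θ, hq, hθinl, hθinr, hω⟩ := hm
  refine ⟨r, A, Qf, θ, hq, hθinl, hθinr, ?_⟩
  -- (transport `hω` along `chiSplittingLine[realDiagonal dW] = chiSplitting[dW]` with the two splittings as BOUND variables: `rw`/`▸`
  --  in the clause would `kabstract` the `dV`-pattern against the `dV′`-occurrence and unfold `chiSplittingLine` in a near-miss `isDefEq`)
  have conv : ∀ {s : adelicPair (Fp L) L (IsCMField.complexConj L) N 1 (Matrix.diagonal dV) (Matrix.diagonal dW) →*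
        adelicMpCont (Fp L) (Fin n) (adelicGram (Fp L) e (realDiagonal L dV hdV) (realDiagonal L dW hdW))}
      {s' : adelicPair (Fp L) L (IsCMField.complexConj L) N 1 (Matrix.diagonal dV') (Matrix.diagonal dW) →*
        adelicMpCont (Fp L) (Fin n) (adelicGram (Fp L) e (realDiagonal L dV' hdV') (realDiagonal L dW hdW))},
      chiSplitting L e dV hdV hdV0 dW hdW hdW0 χ hχu hχs = s → chiSplitting L e dV' hdV' hdV'0 dW hdW hdW0 χ hχu hχs = s' →
      ∀ (p' : adelicPair (Fp L) L (IsCMField.complexConj L) N 1 (Matrix.diagonal dV') (Matrix.diagonal dW))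
        (Ψ : piSchwartzBruhat (Fp L) (Fin N × Fin 1)),
        adelicMpCont.omega (Fp L) (Fin N × Fin 1) _ r
            ((piSBReindex (Fp L) e).symm (adelicMpCont.omega (Fp L) (Fin n)
              (adelicGram (Fp L) e (realDiagonal L dV' hdV') (realDiagonal L dW hdW)) (s' p') (piSBReindex (Fp L) e Ψ))) =
          (piSBReindex (Fp L) e).symm (adelicMpCont.omega (Fp L) (Fin n)
            (adelicGram (Fp L) e (realDiagonal L dV hdV) (realDiagonal L dW hdW)) (s (θ p'))
            (piSBReindex (Fp L) e (adelicMpCont.omega (Fp L) (Fin N × Fin 1) _ r Ψ))) := by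
    rintro s s' rfl rfl
    exact hω
  exact conv (chiSplittingLine_realDiagonal L χ hχu hχs e dV hdV hdV0 dW hdW hdW0 hWd hJW).symm
    (chiSplittingLine_realDiagonal L χ hχu hχs e dV' hdV' hdV'0 dW hdW hdW0 hWd hJW).symm

end Model


/-! ## §4 The rational Gram transporter `C₀ = (diag dV ⊗ diag dW)⁻¹ (diag dV′ ⊗ diag dW)`, `(T_V ⊗ T_W) C = T_V′ ⊗ T_W` -/

section Transporter

variable (L : Type) [Field L] [NumberField L] [IsCMField L] {N M : ℕ}
  (dV : Fin N → L) (hdV : ∀ i, IsCMField.complexConj L (dV i) = dV i) (hdV0 : ∀ i, dV i ≠ 0)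
  (dV' : Fin N → L) (hdV' : ∀ i, IsCMField.complexConj L (dV' i) = dV' i) (hdV'0 : ∀ i, dV' i ≠ 0)
  (dW : Fin M → L) (hdW : ∀ i, IsCMField.complexConj L (dW i) = dW i) (hdW0 : ∀ i, dW i ≠ 0)

include hdV0 hdV'0 hdW0 in
/-- **the Gram transporter**: a RATIONAL `C₀ ∈ GL_{N·M}(L⁺)` with `(diag dV ⊗ diag dW) · C₀ = diag dV′ ⊗ diag dW` (namely
`C₀ = (diag dV ⊗ diag dW)⁻¹ (diag dV′ ⊗ diag dW)`; no isometry is involved), read in `GL_{N·M}(𝔸_{L⁺})`.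
[cite: GelbartRogawski1991, §3.1 p. 454] -/
theorem exists_gramTransporter :
    ∃ (C₀ : GL (Fin N × Fin M) (Fp L)) (C : GL (Fin N × Fin M) (AdeleRing (𝓞 (Fp L)) (Fp L))),
      (C : Matrix (Fin N × Fin M) (Fin N × Fin M) (AdeleRing (𝓞 (Fp L)) (Fp L))) =
          ((C₀ : GL (Fin N × Fin M) (Fp L)) : Matrix (Fin N × Fin M) (Fin N × Fin M) (Fp L)).map
            (algebraMap (Fp L) (AdeleRing (𝓞 (Fp L)) (Fp L))) ∧
        (realDiagonal L dV hdV).map (algebraMap (Fp L) (AdeleRing (𝓞 (Fp L)) (Fp L))) ⊗ₖ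
              (realDiagonal L dW hdW).map (algebraMap (Fp L) (AdeleRing (𝓞 (Fp L)) (Fp L))) *
            (C : Matrix (Fin N × Fin M) (Fin N × Fin M) (AdeleRing (𝓞 (Fp L)) (Fp L))) =
          (realDiagonal L dV' hdV').map (algebraMap (Fp L) (AdeleRing (𝓞 (Fp L)) (Fp L))) ⊗ₖ
            (realDiagonal L dW hdW).map (algebraMap (Fp L) (AdeleRing (𝓞 (Fp L)) (Fp L))) := by
  have hTR := isUnit_det_realDiagonal_kronecker L dV hdV hdV0 dW hdW hdW0
  have hTR' := isUnit_det_realDiagonal_kronecker L dV' hdV' hdV'0 dW hdW hdW0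
  refine ⟨(Matrix.nonsingInvUnit _ hTR)⁻¹ * Matrix.nonsingInvUnit _ hTR',
    Matrix.GeneralLinearGroup.map (algebraMap (Fp L) (AdeleRing (𝓞 (Fp L)) (Fp L)))
      ((Matrix.nonsingInvUnit _ hTR)⁻¹ * Matrix.nonsingInvUnit _ hTR'), rfl, ?_⟩
  rw [realDiagonal_map_kronecker_realDiagonal_map, realDiagonal_map_kronecker_realDiagonal_map]
  show _ * ((((Matrix.nonsingInvUnit _ hTR)⁻¹ * Matrix.nonsingInvUnit _ hTR' : GL (Fin N × Fin M) (Fp L)) :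
      Matrix (Fin N × Fin M) (Fin N × Fin M) (Fp L)).map (algebraMap (Fp L) (AdeleRing (𝓞 (Fp L)) (Fp L)))) = _
  rw [← Matrix.map_mul, Units.val_mul, Matrix.coe_units_inv]
  show ((realDiagonal L dV hdV ⊗ₖ realDiagonal L dW hdW) * ((realDiagonal L dV hdV ⊗ₖ realDiagonal L dW hdW)⁻¹ *
      (realDiagonal L dV' hdV' ⊗ₖ realDiagonal L dW hdW))).map _ = _
  rw [Matrix.mul_nonsing_inv_cancel_left _ _ hTR]

end Transporter

end Literature.NumberTheory.Automorphic.Liu2021.Def411WeilCarriersDoubling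

end
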